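import Literature.AlgebraicGeometry.ComplexMultiplication.AbelianVarietyDomination
import Literature.AlgebraicGeometry.ComplexMultiplication.WeilLineClassesInWeilClassesField
import Literature.AlgebraicGeometry.HodgeTheory.AbelianVarietyMultiplicationPullback
import Literature.AlgebraicGeometry.HodgeTheory.WeilClassesCMReduction
import HarnessLib

/-!
# André 1992 in the weak record form, I: André's product form re-read in the weak record's vocabulary, transport along a
# retraction `s ≫ π = [N]`, and the weak record from a domination by CM-typed biproducts over one Galois CM field

Part 1 (`AndreWeakFormProducts`): on a product `⨁ A_i` of realisations of CM types of one Galois CM field `K` of degree `> 2`,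
André's product form (`HodgeTheory.Andre1992_hodgeClasses_cmTypedProduct_mem_span_pullback_weilLines_holds`) read in the
vocabulary of the weak record `HodgeTheory.Andre1992_hodgeClasses_cmAbelianVariety_mem_span_pullback_weilClasses`
(`andreWeak_cmTypedProduct`: targets `weilClassesField B ψ P (2k)` with `ℚ(ψ) ≅ ℚ[T]/(P)` a CM field of degree `e > 2`), and
transport of span membership along a retraction (`mem_span_of_retraction`).
Part 2 (`AndreWeakFormOfDomination`): the record's target family is stable under pull-backs (`weakTargets_pullback_stable`)
and the weak record follows from a domination (`Domination.AVDominatedBy`) of every CM abelian variety by such a product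
(`andre1992_weak_of_domination`) — Milne 2020 §3, proof of Thm. 1 («We may suppose that A is a product»);
Charles–Schnell Thm. 11.5.21.

Provenance: Literature home (namespace `Literature.AlgebraicGeometry.ComplexMultiplication.AndreWeakForm`) of the Summits-side
`CorCM/AndreWeakFormProducts` and `CorCM/AndreWeakFormOfDomination` (imports `Literature/` and Mathlib only). No case of the
Hodge conjecture is asserted. Lane `lit-hodgefound` (Layer A3/A4), seat p20.

## References
* [Andre1992HodgeCM] Y. André, *Une remarque à propos des cycles de Hodge de type CM* (1992), Théorème (pp. 4–5).
* [Milne2020HodgeClassesAV] J. S. Milne, *Hodge classes on abelian varieties* (2020), §3 Thm. 1 and proof.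
* [CharlesSchnell2014Notes] F. Charles, C. Schnell, *Notes on absolute Hodge classes* (2014), Thm. 11.5.21 and proof (pp. 510–511).
* [Deligne1982HodgeCycles] P. Deligne (notes by J. S. Milne), LNM 900 (1982), §5 and endnote M.12 (p. 64).
* [MumfordAV1970] D. Mumford, *Abelian Varieties* (1970), §19.
-/

noncomputable section

namespace Literature.AlgebraicGeometry.ComplexMultiplication.AndreWeakForm

/-! ## Part 1: André's product form in the weak record's vocabulary; transport along a retraction -/

section Part1

open _root_.CategoryTheory _root_.CategoryTheory.Limits Polynomial NumberField
open Literature.AlgebraicGeometry Literature.AlgebraicGeometry.Motives Literature.AlgebraicGeometry.HodgeTheory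
open Literature.AlgebraicGeometry.ComplexMultiplication
open Literature.NumberTheory.Automorphic.PicardCM (eigenline)
open Literature.AlgebraicGeometry.ComplexMultiplication.AndreProductForm Literature.AlgebraicGeometry.ComplexMultiplication.Milne2020

/-! ## André's theorem in product form, re-read in the weak record's vocabulary -/

section Product

variable (K : Type) [Field K] [NumberField K] [IsCMField K] [IsGalois ℚ K]

/-- **The weak record's conclusion on a CM-typed product over one Galois CM field of degree `> 2`.**
For `B = ⨁_{i<n} A_i`, `(A_i, ι_i, θ_i)` realising CM types `Φ_i` of `K` (`K` Galois CM, `2 < [K:ℚ]`),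
every rational class of Hodge type `(k,k)` in `H^{2k}(B(ℂ); ℂ)` lies in the `ℂ`-span of the target
set of `HodgeTheory.Andre1992_hodgeClasses_cmAbelianVariety_mem_span_pullback_weilClasses` AT `B`
(verbatim its two members; only the second — CM field `ℚ(ψ) ≅ ℚ[T]/(P)` of degree `e > 2` — is
used): by André's theorem in product form (kernel,
`HodgeTheory.Andre1992_hodgeClasses_cmTypedProduct_mem_span_pullback_weilLines_holds`) the class is
a combination of `f_Δ^*(t)`, `t` a rational `(k,k)` `K`-Weil-line class on the twisted slot product
`B_Δ = ⨁_j A_{i_j}`; and `(B_Δ, f_Δ, ψ = act(a₀), P = minpoly a₀, e = [K:ℚ], t)` is a member of the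
second target set: `P` monic irreducible of degree `e` with no real root and one conjugation polynomial
(`Milne2020.isGaloisCMFieldPoly_minpoly`), `P(ψ) = 0` (`Milne2020.eval₂_diagHom_minpoly`),
`e · 2k = 2 dim B_Δ` (`AndreProductForm.two_mul_dim_biproduct`), `t ∈ W_F ⊗ ℂ`
(`Milne2020.weilLineClasses_le_weilClassesField`).
[cite: CharlesSchnell2014Notes, Thm. 11.5.21 and proof (pp. 510–511)]
[cite: Deligne1982HodgeCycles, endnote M.12 (p. 64)] [cite: Milne2020HodgeClassesAV, §3 Thm. 1 and proof]
[cite: Shimura1998, §18.2 Lemma (i)] -/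
theorem andreWeak_cmTypedProduct (hK : 2 < Module.finrank ℚ K) {n : ℕ} (A : Fin n → AbelianVariety ℂ)
    (Φ : Fin n → CMType K) (ι : ∀ i, 𝓞 K →+* End (A i))
    (θ : ∀ i, K →+* Module.End ℂ (complexBetti (A i).X 1))
    (hA : ∀ i, IsCMTypeRealisation (Φ i) (A i) (ι i) (θ i)) (k : ℕ)
    (c : complexBetti (⨁ A).X (2 * k)) (hcQ : IsRationalClass c)
    (hcH : IsOfHodgeType (⨁ A).dim (⨁ A).X (2 * k) k k c) :
    c ∈ Submodule.span ℂ
        ({c' : complexBetti (⨁ A).X (2 * k) |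
            ∃ (B : Motives.AbelianVariety ℂ) (g : (⨁ A).X ⟶ B.X) (d : ℕ) (ψ : B ⟶ B)
              (w : complexBetti B.X (2 * k)),
              B.dim = 2 * k ∧ 0 < d ∧ ψ ≫ ψ = -(d • 𝟙 B) ∧ IsRationalClass w ∧
                IsOfHodgeType (2 * k) B.X (2 * k) k k w ∧ w ∈ weilClassesOf B ψ k d ∧
                c' = complexBetti.map g (2 * k) w} ∪
         {c' : complexBetti (⨁ A).X (2 * k) |
            ∃ (B : Motives.AbelianVariety ℂ) (g : (⨁ A).X ⟶ B.X) (ψ : B ⟶ B) (P : Polynomial ℤ) (e : ℕ)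
              (w : complexBetti B.X (2 * k)),
              P.Monic ∧ P.natDegree = e ∧ 2 < e ∧ Irreducible (P.map (Int.castRingHom ℚ)) ∧
                Polynomial.eval₂ (Int.castRingHom (CategoryTheory.End B)) (ψ : CategoryTheory.End B) P = 0 ∧
                e * (2 * k) = 2 * B.dim ∧
                (∀ ρ : ℂ, Polynomial.eval₂ (Int.castRingHom ℂ) ρ P = 0 → starRingEnd ℂ ρ ≠ ρ) ∧
                (∃ Q : Polynomial ℚ, ∀ ρ : ℂ, Polynomial.eval₂ (Int.castRingHom ℂ) ρ P = 0 →
                    Polynomial.eval₂ (algebraMap ℚ ℂ) ρ Q = starRingEnd ℂ ρ) ∧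
                w ∈ weilClassesField B ψ P (2 * k) ∧ IsRationalClass w ∧
                IsOfHodgeType B.dim B.X (2 * k) k k w ∧ c' = complexBetti.map g (2 * k) w}) := by
  classical
  -- André's theorem in product form (kernel)
  have h := Andre1992_hodgeClasses_cmTypedProduct_mem_span_pullback_weilLines_holds K n A Φ ι θ hA k c
    hcQ hcH
  refine Submodule.span_mono ?_ h
  rintro _ ⟨i, e, t, -, -, htQ, htH, htW, rfl⟩
  refine Or.inr ?_
  -- the separating integer and its minimal polynomial, a Galois CM field polynomial of degree `[K:ℚ]`
  obtain ⟨a₀, hsep⟩ := exists_integer_separating K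
  obtain ⟨hPm, hPe, -, hPirr, hreal, hQ, -⟩ := isGaloisCMFieldPoly_minpoly K a₀ hsep
  -- the twisted slot product and its diagonal action
  let Bs : Fin (2 * k) → AbelianVariety ℂ := fun j => A (i j)
  let act : ∀ j, 𝓞 K →+* End (Bs j) :=
    fun j => (ι (i j)).comp (RingOfIntegers.mapRingEquiv (e j).symm).toRingHom
  -- bases of `H¹` of the slots (for the dimension count)
  have hv : ∀ i₀ : Fin n, ∃ v : Module.Basis (K →+* ℂ) ℂ (complexBetti (A i₀).X 1),
      ∀ σ, v σ ∈ eigenline (θ i₀) σ := fun i₀ => exists_eigenbasis (hA i₀)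
  choose v hv using hv
  have hdim : Module.finrank ℚ K * (2 * k) = 2 * (⨁ Bs).dim := by
    rw [two_mul_dim_biproduct Bs (fun j => v (i j)), Fintype.card_fin, ← NumberField.Embeddings.card K ℂ,
      mul_comm]
  exact ⟨⨁ Bs, (multiDiagonal A i).hom.hom.hom, diagHom K Bs act a₀, minpoly ℤ a₀, Module.finrank ℚ K, t,
    hPm, hPe, hK, hPirr, eval₂_diagHom_minpoly K Bs act a₀, hdim, hreal, hQ,
    weilLineClasses_le_weilClassesField K Bs act a₀ (2 * k) htW, htQ, htH, rfl⟩

end Product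

/-! ## Transport of span membership along a retraction `s ≫ π = [N]` -/

section Transport

/-- **Span membership of rational `(k,k)` classes in a pull-back-stable family of target sets descends
along a retraction.** If `S X ⊆ H^{2k}(X(ℂ); ℂ)` is a family of sets, indexed by complex abelian
varieties, stable under pull-backs along `ℂ`-morphisms `X.X ⟶ Y.X`, and `s : A → P`, `π : P → A` are
homomorphisms with `π ∘ s = [N]_A`, `N ≠ 0` (`A` an isogeny factor of `P`), then: if every rational
`(k,k)` class on `P` lies in `span (S P)`, every rational `(k,k)` class `c` on `A` lies in `span (S A)` —
`π^* c` is rational of type `(k,k)` (pull-backs preserve both), `s^*` maps `span (S P)` into `span (S A)`,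
and `s^* π^* c = [N]^* c = N^{2k} c` (the tree's `complexBetti_map_nsmul_id_apply`, Mumford §19).
[cite: MumfordAV1970, §19 (isogeny factors; [N]^*)] -/
theorem mem_span_of_retraction {k : ℕ} (S : ∀ X : AbelianVariety ℂ, Set (complexBetti X.X (2 * k)))
    (hS : ∀ (X Y : AbelianVariety ℂ) (g : X.X ⟶ Y.X) (w : complexBetti Y.X (2 * k)),
      w ∈ S Y → complexBetti.map g (2 * k) w ∈ S X)
    {A P : AbelianVariety ℂ} (s : A ⟶ P) (π : P ⟶ A) {N : ℕ} (hN : N ≠ 0) (hsπ : s ≫ π = N • 𝟙 A)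
    (hP : ∀ c : complexBetti P.X (2 * k), IsRationalClass c → IsOfHodgeType P.dim P.X (2 * k) k k c →
      c ∈ Submodule.span ℂ (S P))
    (c : complexBetti A.X (2 * k)) (hcQ : IsRationalClass c) (hcH : IsOfHodgeType A.dim A.X (2 * k) k k c) :
    c ∈ Submodule.span ℂ (S A) := by
  have hAsp : IsSmoothProjective A.dim A.X := AbelianVariety.isSmoothProjective_holds (A := A)
  have hPsp : IsSmoothProjective P.dim P.X := AbelianVariety.isSmoothProjective_holds (A := P)
  -- `π^* c` is rational of type `(k,k)`
  set c' : complexBetti P.X (2 * k) := complexBetti.map π.hom.hom.hom (2 * k) c with hc'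
  have hc'Q : IsRationalClass c' := hcQ.pullback _
  have hc'H : IsOfHodgeType P.dim P.X (2 * k) k k c' := hcH.map_of_isSmoothProjective hPsp hAsp _
  have h1 : c' ∈ Submodule.span ℂ (S P) := hP c' hc'Q hc'H
  -- `s^* π^* c = N^{2k} • c`
  have h2 : complexBetti.map s.hom.hom.hom (2 * k) c' = ((N : ℂ) ^ (2 * k)) • c := by
    rw [hc', ← CategoryTheory.comp_apply, ← complexBetti_map_comp_hom, hsπ]
    exact complexBetti_map_nsmul_id_apply A N (2 * k) c
  -- `s^*` maps `span (S P)` into `span (S A)`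
  have h3 : (Submodule.span ℂ (S P)).map (complexBetti.map s.hom.hom.hom (2 * k)).hom ≤
      Submodule.span ℂ (S A) := by
    rw [Submodule.map_span_le]
    intro w hw
    exact Submodule.subset_span (hS A P s.hom.hom.hom w hw)
  have h4 : ((N : ℂ) ^ (2 * k)) • c ∈ Submodule.span ℂ (S A) := by
    rw [← h2]
    exact h3 (Submodule.mem_map_of_mem h1)
  have hNc : ((N : ℂ) ^ (2 * k)) ≠ 0 := pow_ne_zero _ (Nat.cast_ne_zero.mpr hN)
  exact (Submodule.smul_mem_iff _ hNc).mp h4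

end Transport

end Part1

/-! ## Part 2: the weak record from a domination -/

section Part2

open _root_.CategoryTheory _root_.CategoryTheory.Limits NumberField Polynomial
open Literature.AlgebraicGeometry Literature.AlgebraicGeometry.Motives Literature.AlgebraicGeometry.HodgeTheory
open Literature.AlgebraicGeometry.ComplexMultiplication Literature.AlgebraicGeometry.Milne1999
open Literature.AlgebraicGeometry.ComplexMultiplication.Domination

/-! ## The record's target family is stable under pull-backs -/

/-- The two-member target family of the weak André record at a complex abelian variety `X` — pull-backs
`g^*(w)` of rational `(k,k)` Weil classes of an imaginary quadratic field (`weilClassesOf`) or of a CM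
field `ℚ(ψ) ≅ ℚ[T]/(P)` of degree `e > 2` (`weilClassesField`) — is stable under further pull-back along
any `ℂ`-morphism `Y.X ⟶ X.X` (`(g' ≫ g)^* w = g'^* g^* w`). The family is spelled out verbatim (no
definition is introduced). [cite: CharlesSchnell2014Notes, Thm. 11.5.21 (p. 510)] -/
theorem weakTargets_pullback_stable (k : ℕ) (X Y : AbelianVariety ℂ) (g : X.X ⟶ Y.X)
    (w : complexBetti Y.X (2 * k))
    (hw : w ∈
      ({c' : complexBetti Y.X (2 * k) |
          ∃ (B : Motives.AbelianVariety ℂ) (g : Y.X ⟶ B.X) (d : ℕ) (ψ : B ⟶ B)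
            (w : complexBetti B.X (2 * k)),
            B.dim = 2 * k ∧ 0 < d ∧ ψ ≫ ψ = -(d • 𝟙 B) ∧ IsRationalClass w ∧
              IsOfHodgeType (2 * k) B.X (2 * k) k k w ∧ w ∈ weilClassesOf B ψ k d ∧
              c' = complexBetti.map g (2 * k) w} ∪
       {c' : complexBetti Y.X (2 * k) |
          ∃ (B : Motives.AbelianVariety ℂ) (g : Y.X ⟶ B.X) (ψ : B ⟶ B) (P : Polynomial ℤ) (e : ℕ)
            (w : complexBetti B.X (2 * k)),
            P.Monic ∧ P.natDegree = e ∧ 2 < e ∧ Irreducible (P.map (Int.castRingHom ℚ)) ∧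
              Polynomial.eval₂ (Int.castRingHom (CategoryTheory.End B)) (ψ : CategoryTheory.End B) P = 0 ∧
              e * (2 * k) = 2 * B.dim ∧
              (∀ ρ : ℂ, Polynomial.eval₂ (Int.castRingHom ℂ) ρ P = 0 → starRingEnd ℂ ρ ≠ ρ) ∧
              (∃ Q : Polynomial ℚ, ∀ ρ : ℂ, Polynomial.eval₂ (Int.castRingHom ℂ) ρ P = 0 →
                  Polynomial.eval₂ (algebraMap ℚ ℂ) ρ Q = starRingEnd ℂ ρ) ∧
              w ∈ weilClassesField B ψ P (2 * k) ∧ IsRationalClass w ∧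
              IsOfHodgeType B.dim B.X (2 * k) k k w ∧ c' = complexBetti.map g (2 * k) w})) :
    complexBetti.map g (2 * k) w ∈
      ({c' : complexBetti X.X (2 * k) |
          ∃ (B : Motives.AbelianVariety ℂ) (g : X.X ⟶ B.X) (d : ℕ) (ψ : B ⟶ B)
            (w : complexBetti B.X (2 * k)),
            B.dim = 2 * k ∧ 0 < d ∧ ψ ≫ ψ = -(d • 𝟙 B) ∧ IsRationalClass w ∧
              IsOfHodgeType (2 * k) B.X (2 * k) k k w ∧ w ∈ weilClassesOf B ψ k d ∧
              c' = complexBetti.map g (2 * k) w} ∪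
       {c' : complexBetti X.X (2 * k) |
          ∃ (B : Motives.AbelianVariety ℂ) (g : X.X ⟶ B.X) (ψ : B ⟶ B) (P : Polynomial ℤ) (e : ℕ)
            (w : complexBetti B.X (2 * k)),
            P.Monic ∧ P.natDegree = e ∧ 2 < e ∧ Irreducible (P.map (Int.castRingHom ℚ)) ∧
              Polynomial.eval₂ (Int.castRingHom (CategoryTheory.End B)) (ψ : CategoryTheory.End B) P = 0 ∧
              e * (2 * k) = 2 * B.dim ∧
              (∀ ρ : ℂ, Polynomial.eval₂ (Int.castRingHom ℂ) ρ P = 0 → starRingEnd ℂ ρ ≠ ρ) ∧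
              (∃ Q : Polynomial ℚ, ∀ ρ : ℂ, Polynomial.eval₂ (Int.castRingHom ℂ) ρ P = 0 →
                  Polynomial.eval₂ (algebraMap ℚ ℂ) ρ Q = starRingEnd ℂ ρ) ∧
              w ∈ weilClassesField B ψ P (2 * k) ∧ IsRationalClass w ∧
              IsOfHodgeType B.dim B.X (2 * k) k k w ∧ c' = complexBetti.map g (2 * k) w}) := by
  rcases hw with ⟨B, g', d, ψ, w', h1, h2, h3, h4, h5, h6, rfl⟩ |
    ⟨B, g', ψ, P, e, w', h1, h2, h3, h4, h5, h6, h7, h8, h9, h10, h11, rfl⟩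
  · exact Or.inl ⟨B, g ≫ g', d, ψ, w', h1, h2, h3, h4, h5, h6,
      by rw [complexBetti.map_comp, ModuleCat.comp_apply]⟩
  · exact Or.inr ⟨B, g ≫ g', ψ, P, e, w', h1, h2, h3, h4, h5, h6, h7, h8, h9, h10, h11,
      by rw [complexBetti.map_comp, ModuleCat.comp_apply]⟩

/-! ## The weak André record from a domination by CM-typed biproducts over one Galois CM field -/

/-- **Assembly over an abstract domination hypothesis.** If every complex abelian variety of CM type
(`Milne1999.IsOfCMType`, = the record's hypothesis symbol by symbol) is dominated — `s : A → ⨁ B`,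
`π : ⨁ B → A`, `π ∘ s = [N]_A`, `N ≠ 0` — by a finite biproduct of realisations `(B_i, ι_i, θ_i)` of CM
types of ONE Galois CM field `F` with `2 < [F:ℚ]`, then the weak André record
`HodgeTheory.Andre1992_hodgeClasses_cmAbelianVariety_mem_span_pullback_weilClasses` holds: the product
case `AndreWeakForm.andreWeak_cmTypedProduct` (André's trick, kernel) descends along the retraction
(`AndreWeakForm.mem_span_of_retraction`, the record's target family being pull-back stable,
`weakTargets_pullback_stable`). «We may suppose that `A` is such a product» is thereby an explicit,
separately dischargeable input. [cite: CharlesSchnell2014Notes, Thm. 11.5.21 and proof (pp. 510–511)]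
[cite: Milne2020HodgeClassesAV, §3 Thm. 1 and proof («We may suppose that A is a product»)] -/
theorem andre1992_weak_of_domination
    (hdom : ∀ A : AbelianVariety ℂ, IsOfCMType A →
      ∃ (F : Type) (_ : Field F) (_ : NumberField F) (_ : IsCMField F),
        IsGalois ℚ F ∧ 2 < Module.finrank ℚ F ∧
          ∃ (n : ℕ) (B : Fin n → AbelianVariety ℂ) (Φ : Fin n → CMType F)
            (ι : ∀ i, 𝓞 F →+* End (B i)) (θ : ∀ i, F →+* Module.End ℂ (complexBetti (B i).X 1)),
            (∀ i, IsCMTypeRealisation (Φ i) (B i) (ι i) (θ i)) ∧ AVDominatedBy A (⨁ B)) :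
    Andre1992_hodgeClasses_cmAbelianVariety_mem_span_pullback_weilClasses := by
  intro A _hX hCM k c hcQ hcH
  classical
  obtain ⟨F, _instF, _instNF, _instCM, hGal, hF, n, B, Φ, ι, θ, hB, s, π, N, hN, hsπ⟩ := hdom A hCM
  haveI : IsGalois ℚ F := hGal
  -- transfer of the product case along the retraction `s ≫ π = [N]`
  exact mem_span_of_retraction (k := k)
    (fun X : AbelianVariety ℂ =>
      ({c' : complexBetti X.X (2 * k) |
          ∃ (B : Motives.AbelianVariety ℂ) (g : X.X ⟶ B.X) (d : ℕ) (ψ : B ⟶ B)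
            (w : complexBetti B.X (2 * k)),
            B.dim = 2 * k ∧ 0 < d ∧ ψ ≫ ψ = -(d • 𝟙 B) ∧ IsRationalClass w ∧
              IsOfHodgeType (2 * k) B.X (2 * k) k k w ∧ w ∈ weilClassesOf B ψ k d ∧
              c' = complexBetti.map g (2 * k) w} ∪
       {c' : complexBetti X.X (2 * k) |
          ∃ (B : Motives.AbelianVariety ℂ) (g : X.X ⟶ B.X) (ψ : B ⟶ B) (P : Polynomial ℤ) (e : ℕ)
            (w : complexBetti B.X (2 * k)),
            P.Monic ∧ P.natDegree = e ∧ 2 < e ∧ Irreducible (P.map (Int.castRingHom ℚ)) ∧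
              Polynomial.eval₂ (Int.castRingHom (CategoryTheory.End B)) (ψ : CategoryTheory.End B) P = 0 ∧
              e * (2 * k) = 2 * B.dim ∧
              (∀ ρ : ℂ, Polynomial.eval₂ (Int.castRingHom ℂ) ρ P = 0 → starRingEnd ℂ ρ ≠ ρ) ∧
              (∃ Q : Polynomial ℚ, ∀ ρ : ℂ, Polynomial.eval₂ (Int.castRingHom ℂ) ρ P = 0 →
                  Polynomial.eval₂ (algebraMap ℚ ℂ) ρ Q = starRingEnd ℂ ρ) ∧
              w ∈ weilClassesField B ψ P (2 * k) ∧ IsRationalClass w ∧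
              IsOfHodgeType B.dim B.X (2 * k) k k w ∧ c' = complexBetti.map g (2 * k) w}))
    (weakTargets_pullback_stable k) s π hN hsπ
    (fun c' hc'Q hc'H => andreWeak_cmTypedProduct F hF B Φ ι θ hB k c' hc'Q hc'H) c hcQ hcH

end Part2

end Literature.AlgebraicGeometry.ComplexMultiplication.AndreWeakForm

end
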